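import Summits.QuantumFields.YangMills.Theorems.IR.EsPolymerDefs

/-!
# Crux `IR` (item stmt-QuantumFields-19354) — line «es-polymer-decoupling»: what the clauses (P)(I)(D) of a
decoupling–polymer representation give — COVARIANCES REDUCE TO THE HARD-CORE GAS, and PEIERLS

Helper module for item `stmt-QuantumFields-19354` (`--supports … --as helper`; it closes nothing; lead prover
ym-ir-line-mxc-p1 g2, R366 pooled task «es-polymer engine»).  First input of `EsPolymer.stub_polymerEngine : PolymerEngine`
(`Theorems/IR/EsPolymerDefs.lean`): given the DATA of a decoupling–polymer representation `DPR ρ β S b p` — sub-measures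
`ν_Γ` of the torus Wilson measure indexed by families of cell sets, with total masses `P_Γ = ν_Γ(1) = Z⁻¹ ∏_{γ∈Γ} act γ` on
compatible families and `ν_Γ = 0` otherwise, the independence clause (I) and the owner clause (D) —

* §1 `integral_eq_sum_integral` — `∫ F dμ = ∑_Γ ∫ F dν_Γ`; `sum_mass_eq_one` — `∑_Γ P_Γ = 1`; the owner of a cell under a
  compatible family is `∅` or a member of the family within cell-distance `2` (`owner_mem_of_ne_empty`).
* §2 `abs_cov_sub_gasCov_le` — **covariances reduce to the gas**: for block observables `A, B` at cells `c_A, c_B` with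
  `cellDist ≥ 4` and owner functions `Φ_A, Φ_B` as in (D),
  `|Cov_μ(A,B) − Cov_P(Φ_A ∘ owner(·,c_A), Φ_B ∘ owner(·,c_B))| ≤ 2 C_A C_B · P(owner(·,c_A) = owner(·,c_B) ≠ ∅)`
  (the families where one polymer owns both blocks; everywhere else (I)+(D) make `ν_Γ` contribute `P_Γ Φ_A Φ_B` exactly).
* §3 `sum_mass_filter_mem_le_act` — **Peierls**: `P(γ₀ ∈ Γ) ≤ act γ₀` (drop `γ₀`: the remaining family is compatible and
  the map is injective), hence `P(owner_A = owner_B ≠ ∅) ≤ ∑_{γ₀ polymer near both} act γ₀ ≤ ∑ p^{|γ₀|}`.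

What is NOT here: the cluster expansion of the hard-core cell gas (`Cov_P` of owner observables decays in the cell distance
under Kotecký–Preiss) and the lattice-animal count of the polymers near both cells — the remaining inputs of the engine.

HONEST FRAMING: consequences of an ASSUMED representation (the hypotheses are the DPR clauses); nothing here constructs one,
and nothing bears on weak coupling, the crux `IR`, or the Clay YM gap.
-/

set_option autoImplicit false

noncomputable section

open MeasureTheory Finset Function
open Literature.MathematicalPhysics.QuantumFieldTheory Literature.MathematicalPhysics.QuantumLattice

namespace Summit.QuantumFields.YangMills.Cruxes.IR.EsPolymer

/-! ## §0 Cell distance: symmetry and triangle inequality -/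

section CellDist

variable {q : ℕ}

/-- `cycAbs (-z) = cycAbs z`. -/
theorem cycAbs_neg (z : Fin q) : cycAbs (-z) = cycAbs z := by
  rcases Nat.eq_zero_or_pos q with hq | hq
  · subst hq; exact z.elim0
  haveI : NeZero q := ⟨hq.ne'⟩
  unfold cycAbs
  by_cases hz : z = 0
  · subst hz; simp
  · have hzv : 0 < z.val := Nat.pos_of_ne_zero fun h => hz (Fin.ext h)
    have hneg : (-z).val = q - z.val := by
      rw [Fin.val_neg', Nat.mod_eq_of_lt (Nat.sub_lt hq hzv)]
    rw [hneg, Nat.sub_sub_self z.isLt.le, min_comm]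

/-- `cycAbs (a + b) ≤ cycAbs a + cycAbs b`. -/
theorem cycAbs_add_le (a b : Fin q) : cycAbs (a + b) ≤ cycAbs a + cycAbs b := by
  rcases Nat.eq_zero_or_pos q with hq | hq
  · subst hq; exact a.elim0
  haveI : NeZero q := ⟨hq.ne'⟩
  unfold cycAbs
  have ha := a.isLt; have hb := b.isLt
  have hab : (a + b).val = (a.val + b.val) % q := Fin.val_add a b
  rcases Nat.lt_or_ge (a.val + b.val) q with h | h
  · rw [Nat.mod_eq_of_lt h] at hab
    rw [hab]; omega
  · have : (a.val + b.val) % q = a.val + b.val - q := by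
      rw [Nat.mod_eq_sub_mod h, Nat.mod_eq_of_lt (by omega)]
    rw [this] at hab
    rw [hab]; omega

open Fin.CommRing in
/-- Symmetry of the cell distance. -/
theorem cellDist_comm (c c' : Cell q) : cellDist c c' = cellDist c' c := by
  rcases Nat.eq_zero_or_pos q with hq | hq
  · subst hq; exact (c 0).elim0
  haveI : NeZero q := ⟨hq.ne'⟩
  unfold cellDist
  congr 1; funext i
  rw [show c' i - c i = -(c i - c' i) by ring, cycAbs_neg]

open Fin.CommRing in
/-- Triangle inequality for the cell distance. -/
theorem cellDist_triangle (c₁ c₂ c₃ : Cell q) : cellDist c₁ c₃ ≤ cellDist c₁ c₂ + cellDist c₂ c₃ := by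
  rcases Nat.eq_zero_or_pos q with hq | hq
  · subst hq; exact (c₁ 0).elim0
  haveI : NeZero q := ⟨hq.ne'⟩
  unfold cellDist
  refine Finset.sup_le fun i _ => ?_
  have h : c₁ i - c₃ i = (c₁ i - c₂ i) + (c₂ i - c₃ i) := by ring
  rw [h]
  refine (cycAbs_add_le _ _).trans (add_le_add ?_ ?_)
  · exact Finset.le_sup (f := fun i => cycAbs (c₁ i - c₂ i)) (mem_univ i)
  · exact Finset.le_sup (f := fun i => cycAbs (c₂ i - c₃ i)) (mem_univ i)

/-- Under compatibility at most one polymer of the family lies within cell-distance `2` of a given cell, so the owner is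
either `∅` or that polymer: if `owner Γ c ≠ ∅` then `owner Γ c ∈ Γ` and it has a cell within distance `2` of `c`. -/
theorem owner_mem_of_ne_empty {Γ : Finset (Finset (Cell q))} (hΓ : Compatible Γ) {c : Cell q}
    (h : owner Γ c ≠ ∅) : owner Γ c ∈ Γ ∧ ∃ c' ∈ owner Γ c, cellDist c c' ≤ 2 := by
  classical
  set F := Γ.filter fun γ => ∃ c' ∈ γ, cellDist c c' ≤ 2 with hF
  -- the filter has at most one element
  have hsub : ∀ γ₁ ∈ F, ∀ γ₂ ∈ F, γ₁ = γ₂ := by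
    intro γ₁ h₁ γ₂ h₂
    rw [hF, mem_filter] at h₁ h₂
    by_contra hne
    obtain ⟨c₁, hc₁, hd₁⟩ := h₁.2
    obtain ⟨c₂, hc₂, hd₂⟩ := h₂.2
    have h7 := hΓ.2 γ₁ h₁.1 γ₂ h₂.1 hne c₁ hc₁ c₂ hc₂
    have htri := cellDist_triangle c₁ c c₂
    rw [cellDist_comm c₁ c] at htri
    omega
  -- it is nonempty since the sup is not `∅`
  have hne : F.Nonempty := by
    by_contra hemp
    rw [not_nonempty_iff_eq_empty] at hemp
    apply h
    change F.sup id = ∅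
    rw [hemp, sup_empty, bot_eq_empty]
  obtain ⟨γ, hγ⟩ := hne
  have hFeq : F = {γ} := eq_singleton_iff_unique_mem.2 ⟨hγ, fun γ' h' => hsub γ' h' γ hγ⟩
  have howner : owner Γ c = γ := by
    change F.sup id = γ
    rw [hFeq, sup_singleton, id]
  rw [howner]
  rw [hF, mem_filter] at hγ
  exact ⟨hγ.1, hγ.2⟩

end CellDist

/-! ## §1 The data of a representation: finite sums of sub-measures -/

section Data

variable {G : Type} [MeasurableSpace G] {N q : ℕ}
  (ν : Finset (Finset (Cell q)) → Measure (GaugeConfig 4 N G)) (μ : Measure (GaugeConfig 4 N G))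
  [IsProbabilityMeasure μ] (hsum : Finset.univ.sum ν = μ)

include hsum

omit [IsProbabilityMeasure μ] in
/-- Each sub-measure is dominated by `μ`. -/
theorem sub_le (Γ : Finset (Finset (Cell q))) : ν Γ ≤ μ := by
  rw [← hsum]
  exact Finset.single_le_sum (f := ν) (fun i _ => Measure.zero_le (ν i)) (Finset.mem_univ Γ)

/-- Each sub-measure is finite. -/
theorem isFiniteMeasure_sub (Γ : Finset (Finset (Cell q))) : IsFiniteMeasure (ν Γ) :=
  ⟨(Measure.le_iff'.1 (sub_le ν μ hsum Γ) Set.univ).trans_lt (measure_lt_top μ _)⟩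

/-- **`∫ F dμ = ∑_Γ ∫ F dν_Γ`** for bounded measurable `F`. -/
theorem integral_eq_sum_integral {F : GaugeConfig 4 N G → ℝ} (hFm : Measurable F) {C : ℝ} (hC : ∀ U, |F U| ≤ C) :
    ∫ U, F U ∂μ = ∑ Γ, ∫ U, F U ∂(ν Γ) := by
  conv_lhs => rw [← hsum]
  refine integral_finsetSum_measure fun Γ _ => ?_
  haveI := isFiniteMeasure_sub ν μ hsum Γ
  exact Integrable.of_bound hFm.aestronglyMeasurable C (ae_of_all _ fun U => by rw [Real.norm_eq_abs]; exact hC U)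

/-- **Total masses sum to one**: `∑_Γ ν_Γ(1) = 1`. -/
theorem sum_mass_eq_one : ∑ Γ, (ν Γ Set.univ).toReal = 1 := by
  have h : (∑ Γ, ν Γ) Set.univ = 1 := by rw [hsum]; exact measure_univ
  rw [Measure.finsetSum_apply] at h
  rw [← ENNReal.toReal_sum fun Γ _ =>
    (isFiniteMeasure_sub ν μ hsum Γ).measure_univ_lt_top.ne, h, ENNReal.toReal_one]

omit hsum in
/-- A sub-measure of total mass zero (as a real number, the measure being finite) is the zero measure. -/
theorem sub_eq_zero_of_mass {Γ : Finset (Finset (Cell q))} [IsFiniteMeasure (ν Γ)]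
    (h : (ν Γ Set.univ).toReal = 0) : ν Γ = 0 := by
  rw [ENNReal.toReal_eq_zero_iff] at h
  rcases h with h | h
  · exact Measure.measure_univ_eq_zero.1 h
  · exact absurd h (measure_ne_top _ _)

end Data


/-! ## §2 Covariances reduce to the hard-core gas -/

section Cov

variable {G : Type} [MeasurableSpace G] {N q : ℕ}
  (ν : Finset (Finset (Cell q)) → Measure (GaugeConfig 4 N G)) (μ : Measure (GaugeConfig 4 N G))
  [IsProbabilityMeasure μ] (hsum : Finset.univ.sum ν = μ) (hν0 : ∀ Γ, ¬ Compatible Γ → ν Γ = 0)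

include hsum hν0

/-- The `μ`-mean of an observable with owner function `Φ` (clause (D)) is the gas-mean of `Φ ∘ owner`. -/
theorem integral_eq_sum_mass_mul_owner {A : GaugeConfig 4 N G → ℝ} (hAm : Measurable A) {CA : ℝ}
    (hA : ∀ U, |A U| ≤ CA) (c : Cell q) (Φ : Finset (Cell q) → ℝ)
    (hΦ : ∀ Γ, Compatible Γ → ∫ U, A U ∂(ν Γ) = (ν Γ Set.univ).toReal * Φ (owner Γ c)) :
    ∫ U, A U ∂μ = ∑ Γ, (ν Γ Set.univ).toReal * Φ (owner Γ c) := by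
  classical
  rw [integral_eq_sum_integral ν μ hsum hAm hA]
  refine sum_congr rfl fun Γ _ => ?_
  by_cases hΓ : Compatible Γ
  · exact hΦ Γ hΓ
  · rw [hν0 Γ hΓ]; simp

open Classical in
/-- **Covariances reduce to the gas.**  With `P_Γ = ν_Γ(1)` and owner functions `Φ_A, Φ_B` (clause (D)), and the
independence clause (I) for the pair `(A, B)`:
`|Cov_μ(A,B) − (∑_Γ P_Γ Φ_A(o_A) Φ_B(o_B) − ∑ P Φ_A(o_A) · ∑ P Φ_B(o_B))| ≤ 2 C_A C_B ∑_{Γ : o_A = o_B ≠ ∅} P_Γ`. -/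
theorem abs_cov_sub_gasCov_le [Nonempty G] {A B : GaugeConfig 4 N G → ℝ} (hAm : Measurable A) (hBm : Measurable B)
    {CA CB : ℝ} (hA : ∀ U, |A U| ≤ CA) (hB : ∀ U, |B U| ≤ CB) (cA cB : Cell q)
    (hI : ∀ Γ, Compatible Γ → (owner Γ cA ≠ owner Γ cB ∨ (owner Γ cA = ∅ ∧ owner Γ cB = ∅)) →
      (ν Γ Set.univ).toReal * ∫ U, A U * B U ∂(ν Γ) = (∫ U, A U ∂(ν Γ)) * (∫ U, B U ∂(ν Γ)))
    (ΦA ΦB : Finset (Cell q) → ℝ)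
    (hΦA : ∀ Γ, Compatible Γ → ∫ U, A U ∂(ν Γ) = (ν Γ Set.univ).toReal * ΦA (owner Γ cA))
    (hΦB : ∀ Γ, Compatible Γ → ∫ U, B U ∂(ν Γ) = (ν Γ Set.univ).toReal * ΦB (owner Γ cB)) :
    |((∫ U, A U * B U ∂μ) - (∫ U, A U ∂μ) * (∫ U, B U ∂μ)) -
        ((∑ Γ, (ν Γ Set.univ).toReal * (ΦA (owner Γ cA) * ΦB (owner Γ cB))) -
          (∑ Γ, (ν Γ Set.univ).toReal * ΦA (owner Γ cA)) * (∑ Γ, (ν Γ Set.univ).toReal * ΦB (owner Γ cB)))| ≤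
      2 * CA * CB * ∑ Γ ∈ Finset.univ.filter
        (fun Γ => Compatible Γ ∧ owner Γ cA = owner Γ cB ∧ owner Γ cA ≠ ∅), (ν Γ Set.univ).toReal := by
  classical
  have hABm : Measurable fun U => A U * B U := hAm.mul hBm
  have hCA0 : 0 ≤ CA := (abs_nonneg _).trans (hA fun _ => Classical.arbitrary G)
  have hAB : ∀ U, |A U * B U| ≤ CA * CB := fun U => by
    rw [abs_mul]; exact mul_le_mul (hA U) (hB U) (abs_nonneg _) hCA0
  rw [integral_eq_sum_integral ν μ hsum hABm hAB, integral_eq_sum_mass_mul_owner ν μ hsum hν0 hAm hA cA ΦA hΦA,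
    integral_eq_sum_mass_mul_owner ν μ hsum hν0 hBm hB cB ΦB hΦB]
  have hsimp : ((∑ Γ, ∫ U, A U * B U ∂(ν Γ)) -
        (∑ Γ, (ν Γ Set.univ).toReal * ΦA (owner Γ cA)) * (∑ Γ, (ν Γ Set.univ).toReal * ΦB (owner Γ cB))) -
      ((∑ Γ, (ν Γ Set.univ).toReal * (ΦA (owner Γ cA) * ΦB (owner Γ cB))) -
        (∑ Γ, (ν Γ Set.univ).toReal * ΦA (owner Γ cA)) * (∑ Γ, (ν Γ Set.univ).toReal * ΦB (owner Γ cB))) =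
      ∑ Γ, ((∫ U, A U * B U ∂(ν Γ)) - (ν Γ Set.univ).toReal * (ΦA (owner Γ cA) * ΦB (owner Γ cB))) := by
    rw [sum_sub_distrib]; ring
  rw [hsimp]
  refine (abs_sum_le_sum_abs _ _).trans ?_
  -- termwise
  have hterm : ∀ Γ, |(∫ U, A U * B U ∂(ν Γ)) - (ν Γ Set.univ).toReal * (ΦA (owner Γ cA) * ΦB (owner Γ cB))| ≤
      if Compatible Γ ∧ owner Γ cA = owner Γ cB ∧ owner Γ cA ≠ ∅ then 2 * CA * CB * (ν Γ Set.univ).toReal else 0 := by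
    intro Γ
    haveI := isFiniteMeasure_sub ν μ hsum Γ
    set P : ℝ := (ν Γ Set.univ).toReal with hP
    have hP0 : 0 ≤ P := ENNReal.toReal_nonneg
    by_cases hΓ : Compatible Γ
    · by_cases hsame : owner Γ cA = owner Γ cB ∧ owner Γ cA ≠ ∅
      · rw [if_pos ⟨hΓ, hsame⟩]
        -- crude bound on the same-owner families
        have h1 : |∫ U, A U * B U ∂(ν Γ)| ≤ CA * CB * P := by
          have h := norm_integral_le_of_norm_le_const (μ := ν Γ) (f := fun U => A U * B U) (C := CA * CB)
            (ae_of_all _ fun U => by rw [Real.norm_eq_abs]; exact hAB U)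
          simpa [Real.norm_eq_abs, hP, Measure.real, mul_comm] using h
        have h2 : |P * (ΦA (owner Γ cA) * ΦB (owner Γ cB))| ≤ CA * CB * P := by
          have hAo : |P * ΦA (owner Γ cA)| ≤ CA * P := by
            rw [← hΦA Γ hΓ]
            have h := norm_integral_le_of_norm_le_const (μ := ν Γ) (f := A) (C := CA)
              (ae_of_all _ fun U => by rw [Real.norm_eq_abs]; exact hA U)
            simpa [Real.norm_eq_abs, hP, Measure.real, mul_comm] using h
          have hBo : |P * ΦB (owner Γ cB)| ≤ CB * P := by
            rw [← hΦB Γ hΓ]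
            have h := norm_integral_le_of_norm_le_const (μ := ν Γ) (f := B) (C := CB)
              (ae_of_all _ fun U => by rw [Real.norm_eq_abs]; exact hB U)
            simpa [Real.norm_eq_abs, hP, Measure.real, mul_comm] using h
          rcases hP0.lt_or_eq with hPpos | hPzero
          · have hA' : |ΦA (owner Γ cA)| ≤ CA := by
              rw [abs_mul, abs_of_pos hPpos] at hAo
              nlinarith
            have hB' : |ΦB (owner Γ cB)| ≤ CB := by
              rw [abs_mul, abs_of_pos hPpos] at hBo
              nlinarith
            rw [abs_mul, abs_mul, abs_of_pos hPpos]
            calc P * (|ΦA (owner Γ cA)| * |ΦB (owner Γ cB)|) ≤ P * (CA * CB) :=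
                  mul_le_mul_of_nonneg_left (mul_le_mul hA' hB' (abs_nonneg _) hCA0) hP0
              _ = CA * CB * P := by ring
          · rw [← hPzero]; simp
        calc |(∫ U, A U * B U ∂(ν Γ)) - P * (ΦA (owner Γ cA) * ΦB (owner Γ cB))|
            ≤ |∫ U, A U * B U ∂(ν Γ)| + |P * (ΦA (owner Γ cA) * ΦB (owner Γ cB))| := abs_sub _ _
          _ ≤ CA * CB * P + CA * CB * P := add_le_add h1 h2
          _ = 2 * CA * CB * P := by ring
      · rw [if_neg (fun h => hsame h.2)]
        -- independence clause (I): the term vanishes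
        have hcase : owner Γ cA ≠ owner Γ cB ∨ (owner Γ cA = ∅ ∧ owner Γ cB = ∅) := by
          by_cases he : owner Γ cA = owner Γ cB
          · right
            have hA0 : owner Γ cA = ∅ := by
              by_contra hne; exact hsame ⟨he, hne⟩
            exact ⟨hA0, he ▸ hA0⟩
          · left; exact he
        have hIΓ := hI Γ hΓ hcase
        rw [hΦA Γ hΓ, hΦB Γ hΓ] at hIΓ
        refine le_of_eq (abs_eq_zero.2 ?_)
        rcases hP0.lt_or_eq with hPpos | hPzero
        · have : P * ((∫ U, A U * B U ∂(ν Γ)) - P * (ΦA (owner Γ cA) * ΦB (owner Γ cB))) = 0 := by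
            rw [mul_sub, hIΓ]; ring
          rcases mul_eq_zero.1 this with h | h
          · exact absurd h hPpos.ne'
          · exact h
        · have hν : ν Γ = 0 := sub_eq_zero_of_mass ν (Γ := Γ) hPzero.symm
          rw [← hPzero, hν]; simp
    · rw [if_neg (fun h => hΓ h.1)]
      have hPz : P = 0 := by rw [hP, hν0 Γ hΓ]; simp
      rw [hν0 Γ hΓ, hPz]; simp
  calc ∑ Γ, |(∫ U, A U * B U ∂(ν Γ)) - (ν Γ Set.univ).toReal * (ΦA (owner Γ cA) * ΦB (owner Γ cB))|
      ≤ ∑ Γ, (if Compatible Γ ∧ owner Γ cA = owner Γ cB ∧ owner Γ cA ≠ ∅ then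
          2 * CA * CB * (ν Γ Set.univ).toReal else 0) := sum_le_sum fun Γ _ => hterm Γ
    _ = 2 * CA * CB * ∑ Γ ∈ Finset.univ.filter
          (fun Γ => Compatible Γ ∧ owner Γ cA = owner Γ cB ∧ owner Γ cA ≠ ∅), (ν Γ Set.univ).toReal := by
        rw [mul_sum, sum_filter]

end Cov

/-! ## §3 Peierls: the probability that a given polymer is present -/

section Peierls

variable {G : Type} [MeasurableSpace G] {N q : ℕ}
  (ν : Finset (Finset (Cell q)) → Measure (GaugeConfig 4 N G)) (μ : Measure (GaugeConfig 4 N G))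
  [IsProbabilityMeasure μ] (hsum : Finset.univ.sum ν = μ) (hν0 : ∀ Γ, ¬ Compatible Γ → ν Γ = 0)

include hsum hν0

omit [IsProbabilityMeasure μ] hsum hν0 in
/-- A sub-family of a compatible family is compatible. -/
theorem compatible_erase {Γ : Finset (Finset (Cell q))} (hΓ : Compatible Γ) (γ₀ : Finset (Cell q)) :
    Compatible (Γ.erase γ₀) :=
  ⟨fun γ hγ => hΓ.1 γ (mem_of_mem_erase hγ),
    fun γ hγ γ' hγ' hne => hΓ.2 γ (mem_of_mem_erase hγ) γ' (mem_of_mem_erase hγ') hne⟩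

/-- **Peierls bound**: the total mass of the families containing a given cell set `γ₀` is at most its activity,
`∑_{Γ ∋ γ₀} ν_Γ(1) ≤ act γ₀` (clause (P): `ν_Γ(1) = Z⁻¹ ∏_{γ ∈ Γ} act γ` on compatible families, `act ≥ 0`). -/
theorem sum_mass_filter_mem_le_act (act : Finset (Cell q) → ℝ) (hact : ∀ γ, 0 ≤ act γ) {Z : ℝ}
    (hmass : ∀ Γ, Compatible Γ → (ν Γ Set.univ).toReal = Z⁻¹ * ∏ γ ∈ Γ, act γ) (γ₀ : Finset (Cell q)) :
    ∑ Γ ∈ Finset.univ.filter (fun Γ => γ₀ ∈ Γ), (ν Γ Set.univ).toReal ≤ act γ₀ := by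
  classical
  -- the mass as a function of the family, extended by `0`
  set g : Finset (Finset (Cell q)) → ℝ := fun Γ => if Compatible Γ then Z⁻¹ * ∏ γ ∈ Γ, act γ else 0 with hg
  have hgP : ∀ Γ, (ν Γ Set.univ).toReal = g Γ := fun Γ => by
    by_cases hΓ : Compatible Γ
    · simp only [hg, if_pos hΓ]; exact hmass Γ hΓ
    · simp only [hg, if_neg hΓ]; rw [hν0 Γ hΓ]; simp
  have hg0 : ∀ Γ, 0 ≤ g Γ := fun Γ => by rw [← hgP]; exact ENNReal.toReal_nonneg
  have hgsum : ∑ Γ, g Γ = 1 := by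
    rw [← sum_mass_eq_one ν μ hsum]; exact sum_congr rfl fun Γ _ => (hgP Γ).symm
  -- families containing `γ₀`: factor `act γ₀` and drop it
  have hfac : ∀ Γ ∈ Finset.univ.filter (fun Γ => γ₀ ∈ Γ), (ν Γ Set.univ).toReal ≤ act γ₀ * g (Γ.erase γ₀) := by
    intro Γ hΓ
    have hmem : γ₀ ∈ Γ := (mem_filter.1 hΓ).2
    rw [hgP]
    by_cases hc : Compatible Γ
    · simp only [hg, if_pos hc, if_pos (compatible_erase hc γ₀)]
      rw [← mul_prod_erase Γ act hmem]
      exact le_of_eq (by ring)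
    · simp only [hg, if_neg hc]
      exact mul_nonneg (hact γ₀) (hg0 _)
  refine (sum_le_sum hfac).trans ?_
  rw [← mul_sum]
  refine mul_le_of_le_one_right (hact γ₀) ?_
  -- `Γ ↦ Γ.erase γ₀` is injective on the families containing `γ₀`
  set S : Finset (Finset (Finset (Cell q))) := Finset.univ.filter (fun Γ => γ₀ ∈ Γ) with hS
  have hinj : Set.InjOn (fun Γ : Finset (Finset (Cell q)) => Γ.erase γ₀) (S : Set (Finset (Finset (Cell q)))) := by
    intro Γ₁ h₁ Γ₂ h₂ h
    have hm₁ : γ₀ ∈ Γ₁ := (mem_filter.1 (Finset.mem_coe.1 h₁)).2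
    have hm₂ : γ₀ ∈ Γ₂ := (mem_filter.1 (Finset.mem_coe.1 h₂)).2
    rw [← insert_erase hm₁, ← insert_erase hm₂]
    exact congrArg _ h
  calc ∑ Γ ∈ S, g (Γ.erase γ₀)
      = ∑ Γ' ∈ S.image (fun Γ => Γ.erase γ₀), g Γ' := (sum_image hinj).symm
    _ ≤ ∑ Γ', g Γ' := sum_le_sum_of_subset_of_nonneg (subset_univ _) fun Γ _ _ => hg0 Γ
    _ = 1 := hgsum

end Peierls

end Summit.QuantumFields.YangMills.Cruxes.IR.EsPolymer

end
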